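import Summits.ResolutionOfSingularities.ResolutionOfSingularities.Theorems.PurelyInseparableDim4LoopCLocalEscape
import HarnessLib

/-!
# [OURS · res-dim4-pi · F4-C] CROSSING-LINE FIXED POINTS at `(p,q) = (3,3)`: three one-state regions `P₁`, `P`,
  `Q` — blowing up the CROSSING LINE of the two components returns the SAME state at the chart origin, a SPINE
  self-loop, hence a cycle in the LOCAL and in the GLOBAL game for every crossing-line rule (‖ K over `𝔽₃`)

Cell `res-dim4-pi` (D-0157 DOOR 2, wave 2), seat `res-dim4-p-6` g2, desk WORD #55 (b).  SPECIMENS of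
`res-dim4-crit-1` (V-A-30 (L), own hunt i27/rx.py on CARD I-2-7 «crossings-first R_X» of idea-2 g3; located
K = crit-1 ∧ eng-w4 g2 Singular j316916; replayed here a third time by the seat's own script before typing):

* `P₁ = x₁x₃²x₄² + x₁³x₂` — components of the coordinate `3`-fold locus `V(x₁,x₃)`, `V(x₁,x₄)`; their
  CROSSING LINE `U = V(x₁,x₃,x₄)` (`{0,2,3}`) is permissible (`ord_U = 3`); in the `x₄`-chart AND in the
  `x₃`-chart the origin `b = 0` is equimultiple and the cleaned transform is `P₁` again.
* `P = x₁x₃²x₄⁴ + 2x₁³x₂ + 2x₁³x₂⁴` — same components and line; the `x₄`-chart origin returns `P`.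
* `Q = x₁x₂⁴x₃²(1+x₄)⁴ + 2x₁³x₂⁴` — components `V(x₂)` (a divisor) and `V(x₁,x₃)`; crossing line
  `V(x₁,x₂,x₃)` (`{0,1,2}`), `ord = 7`; the `x₂`-chart origin returns `Q`.

crit-1's LAW (FIX) behind them: `F` `T`-homogeneous of `T`-degree `q` for a component `T` and centre
`U = T ⊔ {j}` ⇒ the `x_j`-chart origin returns `F` (`α'_j = |α|_U − q = α_j`).  What is certified here (all by
`decide +kernel` on res-dim4-p-13's presented states, res-dim4-p-8 g2's `LoopC.componentB`/`scopeCertB`, and the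
seat's `LoopCLocal.RSucc`/`localB`):

* §1 data; §2 for each specimen: the components EXACTLY (`components_P1 : IsComponent 3 S P₁ ↔ S = {0,2} ∨
  S = {0,3}` etc.), the crossing line is their union and is permissible, `InCoordinateScope 3` by unit-monomial
  witnesses (`P₁`: `D^{(0,1,0,0)}P₁ = x₁³`, `D^{(1,0,0,0)}P₁ = x₃²x₄²`), and the SELF-LOOP as a `SpineEdge`
  (chart origin), hence as an `Edge` (GLOBAL game) and as a LOCAL reply `LoopCLocal.RSucc 3 localB`
  (`b = 0` vanishes off the centre) — `P₁` loops in BOTH charts `x₃`, `x₄`.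
* §3 rule-class negatives: every coordinate rule `R` over `𝔽₃` that answers a specimen with its crossing line
  (`R s = U`; e.g. idea-2 g3's R_X / R_XT «blow up ⋃ Comp when |Comp| ≥ 2») has the constant in-scope branch:
  `¬ SpineTerminatesUnder 3 R` (the loop is on the SPINE), `¬ TerminatesUnder 3 R`, and the in-scope LOCAL
  branch (`crossing_rule_loses_at_P1/_P/_Q`, `crossingsFirst_loses`) — the first in-scope cycles of a named
  rule class in the
  LOCAL game at `(3,3)` (the maximal-dimensional-component class is NOT affected: it escapes locally,
  `LoopCLocal.loopC_localWins`, and `V(x₁,x₃)` / `V(x₁,x₄)` are available at `P₁`).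

Bookkeeping (honest): the literal loops carry the stationary decorations — `exc ∋` the chart variable(s)
(`{x₃,x₄}` for `P₁`, `{x₄}` for `P`, `{x₂}` for `Q`) and `r` = the new exceptional multiplicity `ord_U F − 3`
(`0` for `P₁`, `P`; `r₂ = 4` for `Q`, `ord_U Q = 7`) — so that `(F, r, exc)` returns LITERALLY; from any other
decoration the `F`-part returns at once and `(r, exc)` is stationary from the second lap.  Scope: `𝔽₃`-rational data at `(3,3)`;
statements about OUR frame and a RULE CLASS; nothing here decides F4-C-loc(3,3) / F4-C-glob(3,3) in their
∃-rule form, and NOTHING here is a statement about resolution of singularities — resolution in dimension `≥ 4`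
/ characteristic `p > 0` is NOT proved by anything in this file.  [OURS · counted 0 · kernel certificate; AI
kernel work, weaker than expert review.]  bears_on: LADDER-RESOLUTION:D157-DOOR2 (res-dim4-pi · F4-C(3,3) ·
C-P1).  Host item (DR-157-C): `stmt-ResolutionOfSingularities-16155`, helper.
-/

set_option linter.dupNamespace false -- mandated namespace of this single-conjunct summit

noncomputable section

open MvPolynomial Finset

namespace Summit.ResolutionOfSingularities.ResolutionOfSingularities.Theorems.PIDim4

namespace CrossingFix

open Literature.AlgebraicGeometry.Resolution
open Literature.AlgebraicGeometry.Resolution.CentreBlowup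
open StepKit LoopC LoopCLocal ComponentThreads

/-! ## §1 The three specimens (res-dim4-crit-1 V-A-30 (L)) as presented states over `𝔽₃` -/

/-- `P₁ = x₁x₃²x₄² + x₁³x₂`, decorations `r = 0`, `exc = {x₃, x₄}`. [OURS · specimen of res-dim4-crit-1] -/
def P1 : SData 4 (ZMod 3) := ⟨[(![1, 0, 2, 2], 1), (![3, 1, 0, 0], 1)], ![0, 0, 0, 0], {2, 3}⟩

/-- `P = x₁x₃²x₄⁴ + 2x₁³x₂ + 2x₁³x₂⁴`, decorations `r = 0`, `exc = {x₄}`. [OURS · specimen of res-dim4-crit-1] -/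
def P : SData 4 (ZMod 3) := ⟨[(![1, 0, 2, 4], 1), (![3, 1, 0, 0], 2), (![3, 4, 0, 0], 2)], ![0, 0, 0, 0], {3}⟩

/-- `Q = x₁x₂⁴x₃²(1+x₄)⁴ + 2x₁³x₂⁴` expanded over `𝔽₃` (`(1+x₄)⁴ = 1 + x₄ + x₄³ + x₄⁴`), decorations
`r = (0,4,0,0)` (the divisor component `V(x₂)` with its multiplicity `ord_U Q − 3 = 4`, `x₂⁴ ∣ Q`), `exc = {x₂}`.
[OURS · specimen of res-dim4-crit-1] -/
def Q : SData 4 (ZMod 3) :=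
  ⟨[(![1, 4, 2, 0], 1), (![1, 4, 2, 1], 1), (![1, 4, 2, 3], 1), (![1, 4, 2, 4], 1), (![3, 4, 0, 0], 2)],
    ![0, 4, 0, 0], {1}⟩

/-- the crossing line `V(x₁,x₃,x₄)` of `P₁` and `P`. [OURS · data] -/
def U1 : Finset (Fin 4) := {0, 2, 3}

/-- the crossing line `V(x₁,x₂,x₃)` of `Q`. [OURS · data] -/
def UQ : Finset (Fin 4) := {0, 1, 2}

/-! ## §2 Components, scope, and the self-loops -/

section P1

/-- **The components of `P₁` are exactly `V(x₁,x₃)` and `V(x₁,x₄)`.** [OURS · ‖ K] -/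
theorem components_P1 (S : Finset (Fin 4)) :
    IsComponent 3 S P1.toState.F ↔ S = {0, 2} ∨ S = {0, 3} := by
  rw [SData.toState_F, isComponent_iff]
  revert S
  decide +kernel

/-- The crossing line `U1 = {0,2,3}` is the union of the two components and is permissible (`ord = 3`), while
the origin is `3`-fold (`ord₀ = 4 ≥ 3`). [OURS · ‖ K] -/
theorem crossing_P1 : U1 = {0, 2} ∪ {0, 3} ∧ IsPermissibleCentre 3 U1 P1.toState.F ∧
    IsPermissibleCentre 3 Finset.univ P1.toState.F :=
  ⟨by decide, (isPermissibleCentre_iff 3 U1 P1.L).mpr (by decide +kernel),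
    (isPermissibleCentre_iff 3 Finset.univ P1.L).mpr (by decide +kernel)⟩

/-- `P₁` is IN COORDINATE SCOPE (unit-monomial witnesses `D^{(0,1,0,0)}P₁ = x₁³`, `D^{(1,0,0,0)}P₁ = x₃²x₄²`;
every prime over `J₃⁺` in `𝔪₀` is `(x₁,x₃)` or `(x₁,x₄)`). [OURS · ‖ K] -/
theorem inScope_P1 : InCoordinateScope 3 P1.toState.F :=
  inCoordinateScope_toState_of_scopeCertB (W := [(![0, 1, 0, 0], ![3, 0, 0, 0]), (![1, 0, 0, 0], ![0, 0, 2, 2])])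
    (by decide +kernel)

/-- **SPINE SELF-LOOP of `P₁` in the `x₄`-chart** of the blow-up of the crossing line. [OURS · ‖ K] -/
theorem spineEdge_P1_x4 : SpineEdge 3 U1 P1.toState P1.toState :=
  spineEdge_of 3 (by decide) (by decide +kernel) (by decide +kernel) (by decide +kernel)

/-- **SPINE SELF-LOOP of `P₁` in the `x₃`-chart** as well. [OURS · ‖ K] -/
theorem spineEdge_P1_x3 : SpineEdge 3 U1 P1.toState P1.toState :=
  spineEdge_of 2 (by decide) (by decide +kernel) (by decide +kernel) (by decide +kernel)

/-- … hence an `Edge` (GLOBAL game of record). [OURS · ‖ K] -/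
theorem edge_P1 : Edge 3 U1 P1.toState P1.toState := edge_of_spineEdge 3 U1 _ _ spineEdge_P1_x4

/-- … and a LOCAL reply (`b = 0` vanishes off the centre): a one-state region of the LOCAL game.
[OURS · ‖ K] -/
theorem local_P1 : RSucc 3 localB P1.toState U1 P1.toState :=
  ⟨3, 0, by decide, rfl, by decide, (isEquimultiplePoint_iff 3 U1 3 0 P1).mpr (by decide +kernel),
    (step_F_ne_zero_iff 3 U1 3 0 P1).mpr (by decide +kernel),
    ((step_eq_iff 3 U1 3 0 P1 P1).mpr (by decide +kernel)).symm⟩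

end P1

section P

/-- **The components of `P` are exactly `V(x₁,x₃)` and `V(x₁,x₄)`.** [OURS · ‖ K] -/
theorem components_P (S : Finset (Fin 4)) :
    IsComponent 3 S P.toState.F ↔ S = {0, 2} ∨ S = {0, 3} := by
  rw [SData.toState_F, isComponent_iff]
  revert S
  decide +kernel

/-- The crossing line `U1` is permissible for `P`, the origin `3`-fold. [OURS · ‖ K] -/
theorem crossing_P : IsPermissibleCentre 3 U1 P.toState.F ∧ IsPermissibleCentre 3 Finset.univ P.toState.F :=
  ⟨(isPermissibleCentre_iff 3 U1 P.L).mpr (by decide +kernel),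
    (isPermissibleCentre_iff 3 Finset.univ P.L).mpr (by decide +kernel)⟩

/-- `P` is in coordinate scope (witnesses `D^{(0,1,0,0)}P = x₁³ · 2(1 + x₂³)`, `D^{(1,0,0,0)}P = x₃²x₄⁴`).
[OURS · ‖ K] -/
theorem inScope_P : InCoordinateScope 3 P.toState.F :=
  inCoordinateScope_toState_of_scopeCertB (W := [(![0, 1, 0, 0], ![3, 0, 0, 0]), (![1, 0, 0, 0], ![0, 0, 2, 4])])
    (by decide +kernel)

/-- **SPINE SELF-LOOP of `P` in the `x₄`-chart** of the blow-up of the crossing line. [OURS · ‖ K] -/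
theorem spineEdge_P : SpineEdge 3 U1 P.toState P.toState :=
  spineEdge_of 3 (by decide) (by decide +kernel) (by decide +kernel) (by decide +kernel)

/-- … an `Edge`. [OURS · ‖ K] -/
theorem edge_P : Edge 3 U1 P.toState P.toState := edge_of_spineEdge 3 U1 _ _ spineEdge_P

/-- … and a LOCAL reply. [OURS · ‖ K] -/
theorem local_P : RSucc 3 localB P.toState U1 P.toState :=
  ⟨3, 0, by decide, rfl, by decide, (isEquimultiplePoint_iff 3 U1 3 0 P).mpr (by decide +kernel),
    (step_F_ne_zero_iff 3 U1 3 0 P).mpr (by decide +kernel),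
    ((step_eq_iff 3 U1 3 0 P P).mpr (by decide +kernel)).symm⟩

end P

section Q

/-- **The components of `Q` are exactly the divisor `V(x₂)` and the plane `V(x₁,x₃)`.** [OURS · ‖ K] -/
theorem components_Q (S : Finset (Fin 4)) :
    IsComponent 3 S Q.toState.F ↔ S = {1} ∨ S = {0, 2} := by
  rw [SData.toState_F, isComponent_iff]
  revert S
  decide +kernel

/-- The crossing line `UQ = {0,1,2}` is the union of the components and is permissible; the origin is
`3`-fold (indeed `ord₀ Q = 7`). [OURS · ‖ K] -/
theorem crossing_Q : UQ = {1} ∪ {0, 2} ∧ IsPermissibleCentre 3 UQ Q.toState.F ∧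
    IsPermissibleCentre 3 Finset.univ Q.toState.F :=
  ⟨by decide, (isPermissibleCentre_iff 3 UQ Q.L).mpr (by decide +kernel),
    (isPermissibleCentre_iff 3 Finset.univ Q.L).mpr (by decide +kernel)⟩

/-- `Q` is in coordinate scope (witnesses `D^{(1,0,0,0)}Q = x₂⁴x₃² · (1+x₄)⁴`,
`D^{(0,0,2,0)}Q = x₁x₂⁴ · (1+x₄)⁴`). [OURS · ‖ K] -/
theorem inScope_Q : InCoordinateScope 3 Q.toState.F :=
  inCoordinateScope_toState_of_scopeCertB (W := [(![1, 0, 0, 0], ![0, 4, 2, 0]), (![0, 0, 2, 0], ![1, 4, 0, 0])])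
    (by decide +kernel)

/-- **SPINE SELF-LOOP of `Q` in the `x₂`-chart** of the blow-up of the crossing line `V(x₁,x₂,x₃)`.
[OURS · ‖ K] -/
theorem spineEdge_Q : SpineEdge 3 UQ Q.toState Q.toState :=
  spineEdge_of 1 (by decide) (by decide +kernel) (by decide +kernel) (by decide +kernel)

/-- … an `Edge`. [OURS · ‖ K] -/
theorem edge_Q : Edge 3 UQ Q.toState Q.toState := edge_of_spineEdge 3 UQ _ _ spineEdge_Q

/-- … and a LOCAL reply. [OURS · ‖ K] -/
theorem local_Q : RSucc 3 localB Q.toState UQ Q.toState :=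
  ⟨1, 0, by decide, rfl, by decide, (isEquimultiplePoint_iff 3 UQ 1 0 Q).mpr (by decide +kernel),
    (step_F_ne_zero_iff 3 UQ 1 0 Q).mpr (by decide +kernel),
    ((step_eq_iff 3 UQ 1 0 Q Q).mpr (by decide +kernel)).symm⟩

end Q

/-! ## §3 The crossing-line rule class loses at the three fixed points — on the spine, locally, globally -/

variable {K : Type} [Field K] [DecidableEq K]

/-- **A spine self-loop kills every rule that plays its centre there** — on the SPINE already (hence in the
LOCAL and in the GLOBAL game), with the constant branch. OURS (elementary). [folklore] -/
theorem not_spineTerminatesUnder_of_selfloop {q : ℕ} {R : CentreRule K} {s : State K}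
    (hperm : IsPermissibleCentre q (R s) s.F) (hloop : SpineEdge q (R s) s s) :
    ¬ SpineTerminatesUnder q R := fun h => h ⟨fun _ => s, fun _ => ⟨hperm, hloop⟩⟩

/-- The same in the full game: `¬ TerminatesUnder q R`. OURS (elementary). [folklore] -/
theorem not_terminatesUnder_of_selfloop {q : ℕ} {R : CentreRule K} {s : State K}
    (hperm : IsPermissibleCentre q (R s) s.F) (hloop : SpineEdge q (R s) s s) :
    ¬ TerminatesUnder q R := fun h => h ⟨fun _ => s, fun _ => ⟨hperm, edge_of_spineEdge q _ _ _ hloop⟩⟩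

/-- **An in-scope spine self-loop is an in-scope infinite branch of LOCAL replies** for every rule playing its
centre there (the constant branch; every reply is the chart origin). OURS (elementary). [folklore] -/
theorem exists_local_inScope_branch_of_selfloop {q : ℕ} {R : CentreRule K} {s : State K}
    (hperm : IsPermissibleCentre q (R s) s.F) (hscope : InCoordinateScope q s.F)
    (hloop : RSucc q localB s (R s) s) :
    ∃ c : ℕ → State K, ∀ k, InCoordinateScope q (c k).F ∧ IsPermissibleCentre q (R (c k)) (c k).F ∧
      RSucc q localB (c k) (R (c k)) (c (k + 1)) :=
  ⟨fun _ => s, fun _ => ⟨hscope, hperm, hloop⟩⟩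

/-- **`P₁` kills every crossing-line rule over `𝔽₃` at `(3,3)`** — any `R` with `R P₁ = V(x₁,x₃,x₄)`: no spine
termination, no termination, and an in-scope infinite branch of LOCAL replies. [OURS · ‖ K] -/
theorem crossing_rule_loses_at_P1 (R : CentreRule (ZMod 3)) (hR : R P1.toState = U1) :
    ¬ SpineTerminatesUnder 3 R ∧ ¬ TerminatesUnder 3 R ∧
      ∃ c : ℕ → State (ZMod 3), ∀ k, InCoordinateScope 3 (c k).F ∧ IsPermissibleCentre 3 (R (c k)) (c k).F ∧
        RSucc 3 localB (c k) (R (c k)) (c (k + 1)) := by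
  have hperm : IsPermissibleCentre 3 (R P1.toState) P1.toState.F := hR ▸ crossing_P1.2.1
  exact ⟨not_spineTerminatesUnder_of_selfloop hperm (hR ▸ spineEdge_P1_x4),
    not_terminatesUnder_of_selfloop hperm (hR ▸ spineEdge_P1_x4),
    exists_local_inScope_branch_of_selfloop hperm inScope_P1 (hR ▸ local_P1)⟩

/-- **`P` kills every crossing-line rule** (`R P = V(x₁,x₃,x₄)`). [OURS · ‖ K] -/
theorem crossing_rule_loses_at_P (R : CentreRule (ZMod 3)) (hR : R P.toState = U1) :
    ¬ SpineTerminatesUnder 3 R ∧ ¬ TerminatesUnder 3 R ∧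
      ∃ c : ℕ → State (ZMod 3), ∀ k, InCoordinateScope 3 (c k).F ∧ IsPermissibleCentre 3 (R (c k)) (c k).F ∧
        RSucc 3 localB (c k) (R (c k)) (c (k + 1)) := by
  have hperm : IsPermissibleCentre 3 (R P.toState) P.toState.F := hR ▸ crossing_P.1
  exact ⟨not_spineTerminatesUnder_of_selfloop hperm (hR ▸ spineEdge_P),
    not_terminatesUnder_of_selfloop hperm (hR ▸ spineEdge_P),
    exists_local_inScope_branch_of_selfloop hperm inScope_P (hR ▸ local_P)⟩

/-- **`Q` kills every crossing-line rule** (`R Q = V(x₁,x₂,x₃)`). [OURS · ‖ K] -/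
theorem crossing_rule_loses_at_Q (R : CentreRule (ZMod 3)) (hR : R Q.toState = UQ) :
    ¬ SpineTerminatesUnder 3 R ∧ ¬ TerminatesUnder 3 R ∧
      ∃ c : ℕ → State (ZMod 3), ∀ k, InCoordinateScope 3 (c k).F ∧ IsPermissibleCentre 3 (R (c k)) (c k).F ∧
        RSucc 3 localB (c k) (R (c k)) (c (k + 1)) := by
  have hperm : IsPermissibleCentre 3 (R Q.toState) Q.toState.F := hR ▸ crossing_Q.2.1
  exact ⟨not_spineTerminatesUnder_of_selfloop hperm (hR ▸ spineEdge_Q),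
    not_terminatesUnder_of_selfloop hperm (hR ▸ spineEdge_Q),
    exists_local_inScope_branch_of_selfloop hperm inScope_Q (hR ▸ local_Q)⟩

/-- **The «crossings-first» class as a hypothesis on the rule** (idea-2 g3's R_X: blow up the union of the
components whenever there are at least two): such a rule answers `P₁` with `U1`, hence loses at `P₁` in the
spine, local and global games over `𝔽₃`. [OURS · ‖ K] -/
theorem crossingsFirst_loses (R : CentreRule (ZMod 3))
    (hR : ∀ s : State (ZMod 3), ∀ S₁ S₂ : Finset (Fin 4), S₁ ≠ S₂ → IsComponent 3 S₁ s.F → IsComponent 3 S₂ s.F →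
      (∀ S, IsComponent 3 S s.F → S = S₁ ∨ S = S₂) → R s = S₁ ∪ S₂) :
    ¬ SpineTerminatesUnder 3 R ∧ ¬ TerminatesUnder 3 R := by
  have hU : R P1.toState = U1 := by
    rw [crossing_P1.1]
    exact hR P1.toState {0, 2} {0, 3} (by decide) ((components_P1 _).mpr (Or.inl rfl))
      ((components_P1 _).mpr (Or.inr rfl)) fun S hS => (components_P1 S).mp hS
  exact ⟨(crossing_rule_loses_at_P1 R hU).1, (crossing_rule_loses_at_P1 R hU).2.1⟩

end CrossingFix

end Summit.ResolutionOfSingularities.ResolutionOfSingularities.Theorems.PIDim4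

end
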